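import Literature.AlgebraicGeometry.AbelianSchemes.TorsionSectionTranslationAction
import Literature.AlgebraicGeometry.AbelianSchemes.PDivisibleGroupOfAbelianScheme
import Literature.AlgebraicGeometry.AbelianSchemes.RigidifiedLineBundleComapHom
import Literature.AlgebraicGeometry.AbelianSchemes.AbelianSchemeOverSectionsBaseChange
import Literature.AlgebraicGeometry.GroupSchemes.GroupSchemeKernelShear
import HarnessLib

/-!
# The kernel pair of `[n] : A → A` is `A ×_S A[n] ⇉ A`, projection and translation by the tautological torsion section
# ([Mumford AV] §15 Thm. 1, proof: `n_X` is a torsor under `X_n`; [Görtz–Wedhorn I] Def. 4.45 (2), «`φ⁻¹(φ(x)) = x · Ker φ`»)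

Topic `Literature/AlgebraicGeometry/AbelianSchemes`; namespace `Literature.AlgebraicGeometry.AbelianSchemes.AbelianSchemeOver`.  ONE `def` with body
(`torsionTautSection`, the diagonal section of `A ×_S A[n] → A[n]`) + theorems; no named fact, no instance, no notation, no `sorry`.  Cell
`hodgecm-mathlib` (D-0151), FLOOR 0, P6 «MOD programme» (crux hLiu418 = stmt-HodgeConjecture-24832), W-line letter `stub_W1` «WeilPairingNatural», σ1
road (memo `F0/P6/B-p08/g32/ROAD-sigma1-WeilPairingNatural.v1.B-p08g32.md`), organ (σ1-d1) «THE KERNEL PAIR OF `[n]`» — the input `H₂ : IsPullback p₁ p₂ g g` of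
★ `Morphisms/TrivialisationFpqcDescent.nonempty_iso_unit_of_cofaceFst_eq_cofaceSnd` ∕ ★ `SectionsFpqcDescent.existsUnique_unitSection_eq` for the finite
flat cover `g := [n]_A`, in the form the Weil-unit currency (★ `TorsionSectionTranslationAction`, ★-to-be `WeilUnitOfTorsionPoint`) reads: second
projection = TRANSLATION by a torsion SECTION of a base change of `A`, followed by the first projection.  HC_CM is proved only modulo the printed
citations until rung 0 closes; nothing here is about HC.

THE PRINT.  [MumfordAV1970] §15 Thm. 1 (p. 143), proof, and §7 Thm. 4: for an isogeny `f : X → Y` with kernel `K`, `X ×_Y X ≅ X × K`,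
`(x, k) ↦ (x, x + k)` — `f` is a `K`-torsor, so that descent along `f` is `K`-invariance; [GortzWedhorn2020] Definition 4.45 (2) p. 117 and
★ `GroupSchemeKernel.isPullback_fst_mul_of_isPullback_unit` (the categorical shear `G ⊗ Ker φ ≅ G ×_{φ,H,φ} G`).  Here `f = [n]`, `K = A[n]`
(★ `torsion`, `torsionι`, `isPullback_torsionι`), and `A ⊗ A[n]` (product in `Over S`) has the same underlying scheme as the base change
`A ×_S A[n] → A[n]` (★ `baseChange` along the structure map of `A[n]`; Mathlib `Over.tensorObj_left`, `rfl`), on which «`x + k`» is the translation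
(★ `translation`) by the TAUTOLOGICAL section `k ↦ (ι k, k)`.

WHAT IS HERE (`A/S` abelian with commutative group law, `n : ℕ`, `t := (A.torsion n).hom : A[n] → S`):
* §1 **`torsionTautSection A n : (A.baseChange t).Sections`** (`_left_fst : ≫ pr_A = ι`, `_left_snd : ≫ pr = 𝟙`), **`torsionTautSection_pow : x₀ ^ n = 1`**
  (so `⟨x₀, _⟩ ∈ torsionSections n`, `torsionTautSection_mem`);
* §2 `translation_left_comp_fst` — on underlying schemes, `t_{x₀} ≫ pr_A = (pr_{A[n]} ≫ ι) · pr_A` in the group `Hom_S(A ×_S A[n], A)` (★ `mul_baseChange_left_comp_fst`);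
* §3 **`isPullback_fst_translation_mulN`** — `IsPullback pr_A (t_{x₀} ≫ pr_A) [n] [n]` on underlying schemes: THE KERNEL PAIR OF `[n]`.

## References
* [MumfordAV1970] D. Mumford, *Abelian Varieties* (1970), §15 Thm. 1 (p. 143), §7 Thm. 4 (p. 72), §20 (p. 184).
* [GortzWedhorn2020] U. Görtz, T. Wedhorn, *Algebraic Geometry I*, 2nd ed. (2020), Definition 4.45 (2) (p. 117), Section (4.7) (p. 108).
-/

set_option autoImplicit false

noncomputable section

-- `(A.baseChange g).X.left = pullback A.X.hom g`, `(𝟙_ (Over T)).left = T` are definitional only above `instances` transparency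
-- (as in ★ `TorsionSectionTranslationAction`, ★ `BarsottiTateGroupBaseChange`).
set_option backward.isDefEq.respectTransparency false

universe u

open CategoryTheory CategoryTheory.Limits AlgebraicGeometry MonoidalCategory CartesianMonoidalCategory
open scoped MonObj CategoryTheory.Obj

namespace Literature.AlgebraicGeometry.AbelianSchemes.AbelianSchemeOver

open Literature.AlgebraicGeometry.GroupSchemes

variable {S : Scheme.{u}} (A : AbelianSchemeOver S) (n : ℕ)

/-! ## §1 The tautological section of `A ×_S A[n] → A[n]` -/

/-- **The TAUTOLOGICAL SECTION `x₀ : A[n] → A ×_S A[n]`, `k ↦ (ι k, k)`** of the base change of `A` along the structure map of its `n`-torsion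
(the universal `n`-torsion point of `A`, read as a section). [cite: MumfordAV1970, §15 Thm. 1 (p. 143)] [cite: GortzWedhorn2020, Section (4.7) (p. 108)] -/
def torsionTautSection : (A.baseChange (A.torsion n).hom).Sections :=
  Over.homMk (pullback.lift (A.torsionι n).left (𝟙 _) (by rw [Over.w (A.torsionι n)]; exact (Category.id_comp _).symm))
    (pullback.lift_snd _ _ _)

/-- `x₀ ≫ pr_A = ι`. [cite: MumfordAV1970, §15 Thm. 1 (p. 143)] -/
@[reassoc (attr := simp)]
theorem torsionTautSection_left_fst :
    (A.torsionTautSection n).left ≫ pullback.fst A.X.hom (A.torsion n).hom = (A.torsionι n).left :=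
  pullback.lift_fst _ _ _

/-- `x₀ ≫ pr_{A[n]} = 𝟙` (it is a section). [cite: MumfordAV1970, §15 Thm. 1 (p. 143)] -/
@[reassoc (attr := simp)]
theorem torsionTautSection_left_snd :
    (A.torsionTautSection n).left ≫ pullback.snd A.X.hom (A.torsion n).hom = 𝟙 _ :=
  pullback.lift_snd _ _ _

/-- **`x₀ ^ n = 1`**: the tautological section is `n`-torsion (`x₀ ≫ [n]_{A ×_S A[n]}` projects to `ι ≫ [n]_A = 1` on `A` and to `𝟙` on `A[n]`).
[cite: MumfordAV1970, §15 Thm. 1 (p. 143)] [cite: MumfordAV1970, §20 (p. 184)] -/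
theorem torsionTautSection_pow : A.torsionTautSection n ^ n = 1 := by
  have h1 : A.torsionTautSection n ^ n = A.torsionTautSection n ≫ (A.baseChange (A.torsion n).hom).mulN n :=
    (comp_mulN _ _ _).symm
  ext : 1
  rw [h1, Over.comp_left, one_left]
  refine pullback.hom_ext ?_ ?_
  · rw [Category.assoc, ← baseChangeHom_mulN, baseChangeHom_left_comp_fst, torsionTautSection_left_fst_assoc, ← Over.comp_left,
      torsionι_comp_mulN, one_baseChange_left_comp_fst, Hom.one_def, Over.comp_left, Over.toUnit_left]
  · rw [Category.assoc, ← AbelianSchemeOver.baseChange_hom, Over.w ((A.baseChange (A.torsion n).hom).mulN n),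
      Over.w (A.torsionTautSection n), Over.w η[(A.baseChange (A.torsion n).hom).X]]

/-- The tautological section lies in `(A ×_S A[n])[n](A[n])` (★ `torsionSections`). [cite: MumfordAV1970, §20 (p. 184)] -/
theorem torsionTautSection_mem [IsCommMonObj (A.baseChange (A.torsion n).hom).X] :
    A.torsionTautSection n ∈ (A.baseChange (A.torsion n).hom).torsionSections n :=
  ((A.baseChange (A.torsion n).hom).mem_torsionSections_iff n _).2 (A.torsionTautSection_pow n)

/-! ## §2 Translation by the tautological section, projected to `A` -/

/-- **`t_{x₀} ≫ pr_A = (pr_{A[n]} ≫ ι) · pr_A`** in the group `Hom_S(A ×_S A[n], A)` — on underlying schemes, translating by the tautological section and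
projecting to `A` is «`(a, k) ↦ ι(k) · a`» (★ `mul_baseChange_left_comp_fst`: the transported group law of `A ×_S A[n]` projects to the group law of `A`).
[cite: MumfordAV1970, §15 Thm. 1 (p. 143)] [cite: GortzWedhorn2020, Section (4.7) (p. 108)] -/
theorem translation_torsionTautSection_left_comp_fst :
    ((A.baseChange (A.torsion n).hom).translation (A.torsionTautSection n)).left ≫ pullback.fst A.X.hom (A.torsion n).hom =
      ((snd A.X (A.torsion n) ≫ A.torsionι n) * fst A.X (A.torsion n)).left := by
  have w : pullback.fst A.X.hom (A.torsion n).hom ≫ A.X.hom = (A.baseChange (A.torsion n).hom).X.hom ≫ (A.torsion n).hom :=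
    pullback.condition
  -- both sides are `(pr_{A[n]} ≫ ι, pr_A) ≫ μ_A`
  rw [translation, Hom.mul_def, Hom.mul_def, Over.comp_left, Over.comp_left, Category.assoc,
    (A.mul_baseChange_left_comp_fst (A.torsion n).hom w), ← Category.assoc]
  congr 1
  rw [Over.lift_left, Over.lift_left]
  refine pullback.hom_ext ?_ ?_
  · rw [Category.assoc, pullback.lift_fst, pullback.lift_fst_assoc, pullback.lift_fst, Over.comp_left, Over.toUnit_left,
      Over.comp_left, Category.assoc, torsionTautSection_left_fst]
    rfl
  · rw [Category.assoc, pullback.lift_snd, pullback.lift_snd_assoc, pullback.lift_snd, Over.id_left, Category.id_comp]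
    rfl

/-! ## §3 The kernel pair of `[n]` -/

variable [IsCommMonObj A.X]

/-- **THE KERNEL PAIR OF `[n]_A` IS `A ×_S A[n] ⇉ A`, `(pr_A, t_{x₀} ≫ pr_A)`**: the square of underlying schemes with the first projection and
«translate by the tautological `n`-torsion section, then project» over `[n] : A → A` twice is CARTESIAN — `[n]` is an `A[n]`-torsor
([MumfordAV1970] §15 Thm. 1, proof; the categorical kernel shear ★ `GroupSchemeKernel.isPullback_fst_mul_of_isPullback_unit` for `φ := [n]`,
`i := ι : A[n] → A` (★ `isPullback_torsionι`), read on underlying schemes and re-ordered by commutativity).  This is the `H₂` of ★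
`TrivialisationFpqcDescent.nonempty_iso_unit_of_cofaceFst_eq_cofaceSnd` for descent along `[n]`. [cite: MumfordAV1970, §15 Thm. 1 (p. 143)]
[cite: GortzWedhorn2020, Definition 4.45 (2) (p. 117)] -/
theorem isPullback_fst_translation_mulN :
    IsPullback (pullback.fst A.X.hom (A.torsion n).hom)
      (((A.baseChange (A.torsion n).hom).translation (A.torsionTautSection n)).left ≫ pullback.fst A.X.hom (A.torsion n).hom)
      (A.mulN n).left (A.mulN n).left := by
  haveI := A.isMonHom_mulN n
  have hK : IsPullback (A.torsionι n) (toUnit _) (A.mulN n) η[A.X] := A.isPullback_torsionι n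
  have hsq := (GroupSchemeKernel.isPullback_fst_mul_of_isPullback_unit (A.mulN n) (A.torsionι n) hK).map (Over.forget S)
  rw [mul_comm] at hsq
  rw [translation_torsionTautSection_left_comp_fst]
  exact hsq

end Literature.AlgebraicGeometry.AbelianSchemes.AbelianSchemeOver

end
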